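import Summits.BirchSwinnertonDyer.Rank1Residual.X11b.BDPRouteAssembly
import Summits.BirchSwinnertonDyer.Rank1Residual.Partition.MainConjectures
import HarnessLib

/-!
# Rank ONE at a GOOD ordinary prime, at a Heegner datum: STEP L (anticyclotomic main conjecture +
# control + BDP, as typed) + Gross–Zagier + Kolyvagin + the rank-0 CYCLOTOMIC main conjecture of the
# twist ⇒ BSD(E,p) — the printed route of row C3 (Jetchev–Skinner–Wan 2017) as a kernel object
# (cell `b2b-bsdres`, GLUE seat; companion of `Partition/MainConjectures.lean`)

HONEST FRAMING (cell `b2b-bsdres`, run/shared/lean/b2b/bsd-rank1-residual/, verbatim in every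
file): the goal of the cell is to DELETE the COMBINATION-SHAPED residual classes of the
Birch–Swinnerton-Dyer formula for ALL analytic-rank `≤ 1` elliptic curves over `ℚ` — "full BSD
formula for every rank `≤ 1` curve in class `C`" assembled STRICTLY from published theorems — so
that the rank-`≤ 1` remainder becomes exactly the CONSTRUCTION-SHAPED classes, which are TYPED
(missing-input `Prop`s), NOT attempted. This is not "finishing BSD". NEW WORK of the cell
(bookkeeping over decls already in the tree), hence under `Summits/`; NO named fact, NO definition.

## What this file does

The rank-one covered rows of RESIDUAL-CASES §a.1 at a good prime — C3 (Jetchev–Skinner–Wan, Camb.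
J. Math. 5 (2017) Thm. 1.2.1) and the `r = 1` halves of C2 (BCS 2025) / C6 (CGS 2025) / C16
(Yan–Zhu 2026) — are proved in print NOT through the cyclotomic main conjecture (which in rank one
needs the Schneider certificate, `Partition/MainConjectures.lean` §1) but through the ANTICYCLOTOMIC
route: for an auxiliary imaginary quadratic `K` (every `ℓ ∣ N` split, `L(E^{d_K},1) ≠ 0`), one
divisibility of the anticyclotomic main conjecture + the anticyclotomic control theorem + the BDP
formula give JSW's lower bound (eq:shalowerK-1) over `K` — in the tree the predicate
`X11b.IndexLowerBoundAt W p K P` ("STEP L", `X11b/BDPRoute.lean`, multr1 seats; OPEN at `p ∥ N`; at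
a good ordinary `p` JSW §7.4.1 prove it — §6.2 Prop. (Lpf1=Sel) (Prop. 38 in the numbering of the
held arXiv:1512.06894 text) from Wan's theorem (§6.1, Thm. 34 there) — for a field `K′` satisfying
(gen-H) WITH "at least one prime divisor of `N` non-split in `K`" (their condition (b): `q` inert or
ramified), NOT for the all-split `K` in which the tree's predicate is read
(`SatisfiesHeegnerHypothesis N K`): in that currency it is a typed input at good `p` too, with no
source vendored) —; Kolyvagin gives the opposite bound; Gross–Zagier and the RANK-ZERO `p`-part of
the twist `E^{d_K}` descend the resulting identity to `BSD(E,p)` (JSW §7.4.1). The multr1 seats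
formalised this descent for class X11b (`p ∥ N`):
`X11b.bsdp_of_indexIdentityAt` (reduction-type-agnostic at `p`) and the assembly
`X11b.bsdp_of_classX11b_of_indexLowerBoundAt` (twist input = Skinner 2016 Thm. C at `p ∥ N`).

`bsdp_rankOne_of_indexLowerBoundAt_of_goodOrd_twist` below is the SAME assembly at a GOOD ORDINARY
`p ≥ 5`, with the twist's rank-zero `p`-part taken not from a `p`-part fact but from the CYCLOTOMIC
MAIN CONJECTURE, AS TYPED: Skinner–Urban 2014 Thm. 3.6.9 clause 3 (`skinner_urban_main_conjecture`,
bsd.S21; surjectivity of `ρ̄` for the twist DERIVED from (irr) + (ram), `surj_of_irr_of_ram`) +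
Greenberg 1999 Thm. 4.1 (`greenberg_charValue_rankZero`) + the period unit + Wuthrich's Lemma 20
(`padicValRat_bsd_rank_zero_of_mainConjecture`, S–U p. 46). So, AT A HEEGNER DATUM, the kernel object
for "anticyclotomic MC (typed as its STEP-L output) + control + cyclotomic MC of the twist (typed) +
Gross–Zagier + Kolyvagin ⇒ BSD(E,p)" exists for every rank-one pair at a good ordinary `p ≥ 5` with
`E[p]` irreducible, a (ram) prime and `p ∤ ∏ c_ℓ` — row C3's locus up to (i) Ribet's lemma "semistable
∧ irr ∧ `p ≥ 5` ⇒ (ram)" (not in the tree), (ii) the CLASS-LEVEL choice of `K` (Friedberg–Hoffstein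
with `p` split, `friedbergHoffstein_exists_heegnerField_split_twist_ne_zero`) and the transport of
(irr)/(ram)/good-ordinary/Tamagawa/unit to the minimal twist model (done by multr1 for X11b in
`X11b/BDPRouteFinal.lean`, `TwistTransport*.lean`; NOT redone here — explicit binders), and (iii) the
typing of JSW (eq:shalowerK-1) at good ordinary `p` as a named fact (today a predicate only). Nothing
here deletes a class or moves a label; C3 is COVERED by JSW Thm. 1.2.1 itself (`RowC3.bsdp`).

References: Jetchev–Skinner–Wan 2017 §7.4.1 (eq:shalowerK-1), (eq:gz for K′), (eq:tamK)
[JetchevSkinnerWan2017]; Skinner–Urban 2014 Thm. 3.6.9, p. 46 [SkinnerUrban2014]; Greenberg LNM 1716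
Thm. 4.1 [GreenbergLNM1716]; Gross–Zagier 1986 V.§2 [GrossZagier1986]; Kolyvagin 1990 Thm. A
[KolyvaginEulerSystems1990]; McCallum 1991 §1 [McCallumLMS1991]; Wuthrich 2014 Lemma 20 [Wuthrich2014];
Greenberg–Vatsal 2000 §3 [GreenbergVatsal2000]; Miller 2011 Def. 1.1 [Miller2011LMS].
-/

set_option autoImplicit false

noncomputable section

open scoped Classical MatrixGroups ModularForm

open CongruenceSubgroup WeierstrassCurve NumberField Literature.NumberTheory.EllipticCurves
  Literature.NumberTheory.EllipticCurves.ModularForms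
  Literature.NumberTheory.EllipticCurves.Rank1Residual
  Literature.NumberTheory.EllipticCurves.KrizLi2019

namespace Summit.BirchSwinnertonDyer.Rank1Residual.X11b

/-- **Rank one at a good ordinary `p ≥ 5`, at a Heegner datum: STEP L + Kolyvagin + Gross–Zagier +
the CYCLOTOMIC main conjecture of the twist (Skinner–Urban, typed) ⇒ `BSD(E,p)`.**
Data as in `X11b.bsdp_of_classX11b_of_indexLowerBoundAt`: `K` imaginary quadratic with the Heegner
hypothesis for the level `N` and `L(E^{d_K},1) ≠ 0`, `P` the Heegner point of a parametrisation datum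
`Dt` with `p ∤ c(Dt)`, `p ∤ #𝓞_K^×`, a globally minimal model `Wd = Cd • E^{(d_K)}` with the two
decidable side conditions (`htam`, `hu`), and for `Wd` at `p`: GOOD ORDINARY reduction (`hordd`;
= that of `E` when `p ∤ d_K`), `Wd[p]` irreducible (`hirrd`), a (ram) prime (`hramd`). The pair:
`ord_{s=1} L(E,s) = 1`, `p ≥ 5`, `E[p]` irreducible, a (ram) prime, `p ∤ ∏_ℓ c_ℓ(E)`. PUBLISHED
inputs (named facts, binders): Gross–Zagier (`hGZ`), Kolyvagin 1990 (`hKo`, `hB`),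
Skinner–Urban 2014 Thm. 3.6.9 (`hSU`, bsd.S21 — the twist's rank-`0` `p`-part is DERIVED from it:
`padicValRat_bsd_rank_zero_of_mainConjecture` with Greenberg Thm. 4.1 `hGr`, Wuthrich Lemma 20 `hW3`,
the period unit `h5`/`h3`), GZK (`hGZK`), modularity (`hmod`, `hpar`). TYPED INPUT: STEP L
`IndexLowerBoundAt W p K P` (JSW (eq:shalowerK-1): in print "anticyclotomic MC divisibility + control +
BDP", proved by JSW §7.4.1 / §6.2 Prop. (Lpf1=Sel) for `K` with some `q ∣ N` NON-split (Wan's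
hypothesis); for the all-split `K` of this binder NOT in print from JSW — a typed input, no tree
fact). CONCLUSION: `BSDp W p`. Chain: STEP L +
Kolyvagin ⇒ identity over `K` (`indexIdentityAt_of_lowerBound_of_kolyvagin`) ⇒ descent
(`bsdp_of_indexIdentityAt`). [cite: JetchevSkinnerWan2017, §7.4.1 (pp. 30–31)]
[cite: SkinnerUrban2014, Thm. 3.6.9 (p. 45) and p. 46] [cite: GreenbergLNM1716, Thm. 4.1 (p. 102)]
[cite: McCallumLMS1991, §1 Theorem (Kolyvagin), p. 296] [cite: Miller2011LMS, Def. 1.1] -/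
theorem bsdp_rankOne_of_indexLowerBoundAt_of_goodOrd_twist
    (W : WeierstrassCurve ℚ) [W.IsElliptic] [W.IsGloballyMinimal] (p : ℕ) [Fact p.Prime]
    (N : ℕ) [NeZero N] (K : Type) [Field K] [NumberField K]
    (Dt : ModularParametrizationData W N) (H : HeegnerDatum N (NumberField.discr K)) (ι : K →+* ℂ)
    (P : (W.baseChange K).toAffine.Point)
    -- the published inputs (named facts of the tree)
    (hGZ : gross_zagier N W K) (hKo : kolyvagin N W K)
    (hB : Kolyvagin1990_padicValNat_card_sha_le N W K)
    (hSU : ∀ (W : WeierstrassCurve ℚ) [W.IsElliptic] [W.IsGloballyMinimal] (p : ℕ) [Fact p.Prime]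
      (κ : ZpExtension ℚ p) (γ : Field.absoluteGaloisGroup ℚ) (N : ℕ) [NeZero N]
      (f : CuspForm (Gamma0 N) 2),
      skinner_urban_main_conjecture W p (κ := κ) (γ := γ) (f := f))
    (hGr : greenberg_charValue_rankZero)
    (hW3 : Wuthrich2014.lemma20_surjective_threeAdic_of_semistable)
    (h5 : realPeriodRat_eq_unit_mul_plusPeriod) (h3 : realPeriodRat_eq_unit_mul_plusPeriod_three)
    (hGZK : rank_eq_analyticRank_of_analyticRank_le_one) (hmod : hasEntireLFunction_rat)
    (hpar : nonempty_modularParametrizationData)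
    -- the pair
    (hr : W.analyticRank = 1) (hp5 : 5 ≤ p) (hirr : Irr W p) (hram : Ram W p)
    (htam0 : ¬ p ∣ W.tamagawaProduct)
    -- the Heegner data
    (hK : IsImaginaryQuadratic K) (hHN : SatisfiesHeegnerHypothesis N K)
    (hP : WeierstrassCurve.Affine.Point.map ι.toRatAlgHom P = heegnerPointComplex Dt H)
    (hc : ¬ (p : ℤ) ∣ Dt.c) (hμ : ¬ p ∣ Units.torsionOrder K)
    (hLt : (W.quadraticTwist (NumberField.discr K : ℚ)).entireLFunction 1 ≠ 0)
    -- a globally minimal model of the twist, Skinner–Urban's hypotheses for it, the side conditions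
    (Wd : WeierstrassCurve ℚ) [Wd.IsElliptic] [Wd.IsGloballyMinimal] (Cd : VariableChange ℚ)
    (hWd : Cd • W.quadraticTwist (NumberField.discr K : ℚ) = Wd)
    (hordd : GoodOrd Wd p) (hirrd : Irr Wd p) (hramd : Ram Wd p)
    (htam : padicValNat p Wd.tamagawaProduct = padicValNat p W.tamagawaProduct)
    (hu : padicValRat p (Cd.u : ℚ) = 0)
    -- the typed input (STEP L at the datum)
    (hL : IndexLowerBoundAt W p K P) : BSDp W p := by
  have hp2 : p ≠ 2 := by omega
  have hp3 : 3 ≤ p := by omega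
  have hD0 : (NumberField.discr K : ℚ) ≠ 0 := by exact_mod_cast NumberField.discr_ne_zero K
  haveI hEt : (W.quadraticTwist (NumberField.discr K : ℚ)).IsElliptic :=
    W.isElliptic_quadraticTwist hD0
  -- `ρ̄_{E,p}` is surjective (irr + ram)
  have hsurj : Surj W p := surj_of_irr_of_ram W p hirr hram
  -- the Heegner point has infinite order (Gross–Zagier, `L'(E,1) ≠ 0`, `L(E^D,1) ≠ 0`)
  have hL0 : W.entireLFunction 1 = 0 := entireLFunction_one_eq_zero_of_analyticRank_eq_one hr
  obtain ⟨-, hderiv⟩ := leadingLCoeff_eq_deriv_of_analyticRank_eq_one hr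
  have hLK : LDerivEK W K ≠ 0 := by
    rw [lDerivEK_eq_deriv_mul W K hmod hL0]; exact mul_ne_zero hderiv hLt
  have hPH : IsHeegnerPoint N W K P := ⟨Dt, H, ι, hP⟩
  have hPinf : ¬ IsOfFinAddOrder P :=
    (lDerivEK_ne_zero_iff_not_isOfFinAddOrder W N K hGZ hK hHN hPH).mp hLK
  -- STEP L + STEP U ⇒ the identity over `K`
  have hid : Finite (W.baseChange K).sha → IndexIdentityAt W p K P := fun _ =>
    indexIdentityAt_of_lowerBound_of_kolyvagin W p hB hK hHN hPH hPinf hp2 hsurj htam0 hL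
  -- the twist: analytic rank `0`, finiteness, and its rank-`0` `p`-part FROM THE MAIN CONJECTURE
  have hLt' : (W.quadraticTwist (NumberField.discr K : ℚ)).entireLFunction = Wd.entireLFunction := by
    rw [← hWd, entireLFunction_smul]
  have hLd1 : Wd.entireLFunction 1 ≠ 0 := by rw [← hLt']; exact hLt
  have hfinSd : Finite Wd.sha := (hGZK Wd (by
    rw [(Wd.analyticRank_eq_zero_iff_holds (hmod Wd)).2 hLd1]; exact zero_le_one)).2
  have hsurjd : Surj Wd p := surj_of_irr_of_ram Wd p hirrd hramd
  have hS30 : padicValRat_bsd_rank_zero :=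
    padicValRat_bsd_rank_zero_of_mainConjecture hpar hSU
      (fun W _ _ hgood hsurj ↦ hW3 W (Or.inl hgood) hsurj) hGr
      (periodUnit_of_realPeriodRat_eq_unit_mul_plusPeriod h5 h3)
  have htw := hS30 Wd p hp3 hordd.1 hordd.2 hirrd hramd hLd1 hsurjd hfinSd
  exact bsdp_of_indexIdentityAt W p N K Dt H ι P hGZ hKo hGZK hmod hK hHN hP hp2 hc hμ hr hLt Wd Cd
    hWd htw htam hu hid

end Summit.BirchSwinnertonDyer.Rank1Residual.X11b

end
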